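import Summits.QuantumFields.YangMills.Theorems.BalabanUVNodesN22W1StripAtRecord12
import Summits.QuantumFields.YangMills.Theorems.BalabanUVNodesRateReadingOfRecord12

/-!
# BalabanUVNodes ∕ node N22 = NE9 — THE STRIP INDUCTION AT THE W1 OBJECT, MODULE 9: THE EDGE N18 → N22 AT THE NAMED W1 READING —
# the oscillation-fading input (O) of ROAD 3 DERIVED from node N18's NE5 ALONG THE LEVEL PAIRINGS, so that `S_N22 (RRec₁₂ 𝔯_W1)` follows from
# `S_N18 (RRec₁₂ 𝔯_W1)` BY NAME + STRIP-(1.18) + the pairing coherence + the inputs' numerals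

Cell `pub-ymgap`, HUMAN RULING D-0062 (Track A), R134 ACCELERATION re-seat `pub-ymgap-dag-n22-c` (strategy s1: «the history-Lipschitz estimate (2.40)–(2.41)
p. 21 of [II] on the W1 object»), generation 3, module 9 = trigger (t3) of the seat's HANDOFF («replace (O) by `S_N18`»), done for the W1 reading's PER-LEVEL
types.  THEOREMS ONLY; imports module 7 `…N22W1StripAtRecord12` (p468577; through it modules 1–3, dag-n22-e g2's `…N22AtW1Reading12` p467930 and layer B
`…RateCarriersOfRecord12` p466281: `RRec₁₂`, `u3OfRecord₁₂`, `s_N18_rRec₁₂_iff`, and node00-def-W1's named reading `Node00/RateRecordW1Reading.lean` p465810: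
`ReadingData`, `LevelPairing`, `u3Objects`) and dag-n22-e g2's module 6 `…RateReadingOfRecord12` (p469629: the edition-1 reading of record `readingOfRecord₁₂`)
BY NAME.  `--supports` K3′ (helper).

WHY.  After modules 1–8, node N22's stub at the Stage-12 home for the named W1 reading, `S_N22 (RRec₁₂ 𝔯_W1)`, follows from STRIP-(1.18) (⇐ the ONE displayed
level-T one-step hypothesis, node N10's lane), the readings inside the spaces, the inputs' numerals and the oscillation-fading input
  (O)  `|E_A(S k)(X; g; U) − E_A(S k)(X; g′; U)| ≤ C₀ · θ₅^{j − a} · e^{−κ d_j(X)}` for window histories `g, g′` agreeing at every index `≥ a`, `a ≤ j`,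
which module 7 DISPLAYS in node N18's shape.  Node N18's stub at the same home is NE5 — `|E_A(S k′)(X₁; h; T₀U₁) − E_B(S (k′+1))(pair X₁; b∷h; U₁)| ≤
C₅ θ₅^{j₁} e^{−κ d_{j₁}(X₁)}` per pairing level `k′` (`ReadingData.ne5_u3Objects_iff`).  The tree's derivations of (O) from NE5 (dag-n22-e's
`s_N22_rRec₁₂_of_s_N18_analytic`, `…N22KnitFiniteTower.oscFading_of_ne5_below`, ne9's `TowerCarriers`) peel the oldest couplings along a tower with ONE domain
type and ONE background type for all run lengths; the W1 reading has PER-LEVEL types (`W1.Dom (F.P k) M`, `(D.pairing k).BgA`) joined by the UNPRINTED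
level pairings, so the peeling is re-derived here ALONG THE PAIRINGS: changing the `a` oldest couplings of a history is undone by descending `a` run
lengths (NE5 at pairing level `k−1` with `b := g 0` turns run A of length `k` at `(pair X₁, embB U₁)` into run B of pairing `k−1` at `(X₁, U₁)`,
`prependCoupling_head_tail`), under three DISPLAYED coherence clauses on the pairings — (C1) `pair` raises the creation step by one, preserves `d_j`, and
reaches every domain of creation step `≥ 1`; (C2) every run-A background of pairing `k′+1` is read as some run-B background of pairing `k′` — and the reading
pin (J) «the run of `k` steps creates no term after step `k`» (the level-`j` entries with `j > k` of the run-length-`k` tower are junk of the typing; NE5 cannot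
see them).  (C1)(C2) are exactly the faces of node00-def-W1 g3's pairing of record (INTENT-1, pub-ymgap INBOX l.14197: `pairOfRecord_fst`, `dj_pairOfRecord`,
`range_pairOfRecord`, `LevelPairing.ofRecord_embA ∕ _embB`); module 10 discharges them there on its landing.

WHAT.
* §1 `abs_EA_sub_le_of_ne5_below_aux` — the induction on `a` (sharp bound `(2C₅∕(1−θ₅))·(θ₅^{j−a} − θ₅^{j})·e^{−κ d_j(X)}` for `j ≤ k`);
  `oscFading_EA_of_ne5_below` — (O) for run A's level functional `(D.pairing k).EA (D.S k)` with constant `2C₅∕(1−θ₅)` from NE5 at the pairing levels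
  `k′ < k` + (C1)(C2)(J) + `0 ≤ C₅`, `0 ≤ θ₅ < 1`.
* §2 `oscFading_w1Reading_of_n18At_below` — module 7 §2's `hO` clause for `D.u3Objects θ.γ` at run length `k` from `∀ k′ < k, N18At (u3OfRecord₁₂ θ (D.u3Objects θ.γ) k′)`
  + (C1)(C2)(J) + `2C₅∕(1−θ₅) ≤ C₀`; `n22At_u3OfRecord₁₂_w1Reading_of_n18Below_stripBound` (module 7 §2 with (O) DERIVED);
  `n22At_u3OfRecord₁₂_w1Reading_of_n18Below_termwise226Strip` (module 7 §4 likewise: level T end to end).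
* §3 `s_N22_rRec₁₂_w1Assignment_of_s_N18_stripBound` — THE EDGE AT THE READING OF RECORD: `S_N18 (RRec₁₂ (RateReading₁₂.ofAssignment (W1.assignment₁₂ 𝔇) ne1))`
  + (θ-form, per admissible Stage-12 tuple with provisos) coherence + junk-freeness + numerals + STRIP per run length with the readings inside the spaces
  ⟹ `S_N22 (RRec₁₂ (same))`; `s_N22_readingOfRecord₁₂_of_s_N18_stripBound` — at dag-n22-e's edition-1 reading of record `readingOfRecord₁₂ w1 ℓ₃ ne2 ne1`.

HONEST FRAMING.  Count-neutral by-name knit; NOT a discharge of N22 (STRIP ⇐ the displayed level-T hypothesis; (C1)(C2) definer-lane faces displayed here; (J) a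
reading pin displayed here; readings-in-the-spaces is Theorem-1 content; the numerals are the reading's; `S_N18` is node N18's stub, consumed as a hypothesis —
NOT proved; no inhabitant of `IsDatumOfRecord₁₂C` claimed, K0′).  NE5 ∕ NE9 NOT IN PRINT ([I] p. 263 «C^∞ … (or analytic)» in the last coupling only; (0.24)–(0.25)
compare SUMS of two runs); one finite four-torus programme at fixed ε — NOT infinite volume, NOT OS on ℝ⁴, NOT a mass gap, NOT Clay.  0 `sorry`, 0 `def`,
standard axioms.

References (TYPES only): [I] = [Balaban1987RG1] (0.24)–(0.25) p. 257, Thm 1 p. 259, (1.18) p. 263; [II] = [Balaban1988RG2Cluster] (2.13)–(2.14) pp. 14–15,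
(2.40)–(2.41) p. 21.
-/

noncomputable section

namespace YMDAG.N22.W1

open Set Metric
open scoped BigOperators
open Literature.MathematicalPhysics.QuantumFieldTheory.Balaban1983to89
open Literature.MathematicalPhysics.QuantumFieldTheory.Balaban1983to89.T4Continuum
open Literature.MathematicalPhysics.QuantumFieldTheory.Balaban1983to89.T4OutputRate
open Literature.MathematicalPhysics.QuantumFieldTheory.Balaban1983to89.TreeLengthTorus (TPt TDom tsys torusTreeLen torusTreeLen_nonneg)
open Literature.MathematicalPhysics.QuantumFieldTheory.Balaban1983to89.B12TreeDecay (K₀ K₀_pos)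
open Literature.MathematicalPhysics.QuantumFieldTheory.Balaban1983to89.B13Lemma3TorusData (TBond)
open Literature.MathematicalPhysics.QuantumFieldTheory.Balaban1983to89.B13Lemma3TorusTerms (terms weight)
open Literature.MathematicalPhysics.QuantumFieldTheory.Balaban1983to89.B13Lemma3TorusSocket (Lemma3Numerics)
open Literature.MathematicalPhysics.QuantumFieldTheory.Balaban1983to89.Node00
  (Stage12Params IsDatumOfRecord₁₂C U3Objects₁₁ U3Letters₁₁ MatA prependCoupling prependCoupling_head_tail)
open Literature.MathematicalPhysics.QuantumFieldTheory.Balaban1983to89.Node00.Sect2 (domSys domCount CPair)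
open Literature.MathematicalPhysics.QuantumFieldTheory.Balaban1983to89.Node00.W1
open YMDAG.UVSplit

variable {N : ℕ} [NeZero N]

/-! ## §1 (O) for run A's level functional from NE5 at the pairing levels below, along the level pairings -/

section Descent

variable {F : T4Family} {𝔸 : Type*} {M : ℕ} (D : ReadingData F 𝔸 M) (γ : ℝ) (K : ℕ)

/-- **THE PEELING ALONG THE LEVEL PAIRINGS (induction on the number `a` of old couplings changed; sharp bound).**  For the W1 reading data `D` (towers `D.S k`
on `F.P k`, level pairings `D.pairing k`): if (C1) every pairing map raises the creation step by one and preserves `d_j`, and reaches every domain of creation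
step `≥ 1`, (C2) every run-A background of pairing `k′+1` is the reading of some run-B background of pairing `k′`, and NE5 holds at the pairing levels `k′ < K` on
the window `]0, γ]` with letters `(κ, θ, C₅)`, `θ < 1`, then for `k ≤ K`, window histories `g, g′` agreeing at every index `≥ a`, and a domain `X` of run length
`k` with `a ≤ j ≤ k` (`j = X.1`): `|E_A(S k)(X; g; U) − E_A(S k)(X; g′; U)| ≤ (2C₅∕(1−θ))·(θ^{j−a} − θ^{j})·e^{−κ d_j(X)}`.  Step `a+1`: write `X = pair X₁`,
`embA U = embB U₁`; run A's value at `g` IS run B's of pairing `k−1` at `(g 0)∷(tail g)` (`prependCoupling_head_tail`); NE5 with `b := g 0` and `b := g′ 0`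
moves both values to run A of length `k−1` at `(X₁, T₀U₁)` with the TAILS, which agree from `a` on — induction. [folklore] -/
theorem abs_EA_sub_le_of_ne5_below_aux
    (hfst : ∀ (k : ℕ) (X₁ : Node00.W1.Dom (F.P k) M), ((D.pairing k).pair X₁).1 = X₁.1 + 1)
    (hdj : ∀ (k : ℕ) (X₁ : Node00.W1.Dom (F.P k) M),
      (domSys (F.P (k + 1)) M ((D.pairing k).pair X₁).1).dj ((D.pairing k).pair X₁).2 = (domSys (F.P k) M X₁.1).dj X₁.2)
    (hsurj : ∀ (k : ℕ) (X : Node00.W1.Dom (F.P (k + 1)) M), 1 ≤ X.1 → ∃ X₁ : Node00.W1.Dom (F.P k) M, (D.pairing k).pair X₁ = X)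
    (hbg : ∀ (k : ℕ) (U : (D.pairing (k + 1)).BgA), ∃ U₁ : (D.pairing k).BgB, (D.pairing k).embB U₁ = (D.pairing (k + 1)).embA U)
    {κ θ C₅ : ℝ} (hθ1 : θ < 1)
    (h5 : ∀ k' : ℕ, k' < K → ∀ b : ℝ, 0 < b → b ≤ γ →
      NE5 (C := (D.pairing k').carriers) ((D.pairing k').EA (D.S k')) ((D.pairing k').EB (D.S (k' + 1)) b) (Window γ) κ θ C₅) :
    ∀ (a k : ℕ), k ≤ K → ∀ g ∈ Window γ, ∀ g' ∈ Window γ, (∀ n, a ≤ n → g n = g' n) →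
      ∀ (U : (D.pairing k).BgA) (X : Node00.W1.Dom (F.P k) M), a ≤ X.1 → X.1 ≤ k →
        |(D.pairing k).EA (D.S k) g U X - (D.pairing k).EA (D.S k) g' U X| ≤
          2 * C₅ / (1 - θ) * (θ ^ (X.1 - a) - θ ^ X.1) * Real.exp (-(κ * (domSys (F.P k) M X.1).dj X.2)) := by
  intro a
  induction a with
  | zero =>
    intro k _ g _ g' _ hag U X _ _
    have hgg : g = g' := funext fun n => hag n (Nat.zero_le n)
    simp [hgg]
  | succ a ih =>
    intro k hk g hg g' hg' hag U X haX hXk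
    obtain ⟨k₀, rfl⟩ : ∃ k₀, k = k₀ + 1 := ⟨k - 1, by omega⟩
    obtain ⟨X₁, rfl⟩ := hsurj k₀ X (by omega)
    obtain ⟨U₁, hU₁⟩ := hbg k₀ U
    have hj : ((D.pairing k₀).pair X₁).1 = X₁.1 + 1 := hfst k₀ X₁
    rw [hj] at haX hXk
    -- the tails of the two histories lie in the window and agree from `a` on
    have htg : (fun i => g (i + 1)) ∈ Window γ := fun i => hg (i + 1)
    have htg' : (fun i => g' (i + 1)) ∈ Window γ := fun i => hg' (i + 1)
    have htag : ∀ n, a ≤ n → (fun i => g (i + 1)) n = (fun i => g' (i + 1)) n := fun n hn => hag (n + 1) (by omega)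
    -- run A of length `k₀ + 1` at `(pair X₁, embA U = embB U₁)` IS run B of pairing `k₀` with the oldest coupling prepended
    have hkey : ∀ h : ℕ → ℝ, (D.pairing (k₀ + 1)).EA (D.S (k₀ + 1)) h U ((D.pairing k₀).pair X₁) =
        (D.pairing k₀).EB (D.S (k₀ + 1)) (h 0) (fun i => h (i + 1)) U₁ X₁ := fun h => by
      rw [LevelPairing.EA_apply, LevelPairing.EB_apply, prependCoupling_head_tail, hU₁]
    -- NE5 at the pairing level `k₀ < K` for the two histories
    have h1 : |(D.pairing k₀).EA (D.S k₀) (fun i => g (i + 1)) ((D.pairing k₀).transport U₁) X₁ -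
          (D.pairing k₀).EB (D.S (k₀ + 1)) (g 0) (fun i => g (i + 1)) U₁ X₁| ≤
        C₅ * θ ^ X₁.1 * Real.exp (-(κ * (domSys (F.P k₀) M X₁.1).dj X₁.2)) :=
      h5 k₀ (by omega) (g 0) (hg 0).1 (hg 0).2 _ htg U₁ X₁
    have h1' : |(D.pairing k₀).EA (D.S k₀) (fun i => g' (i + 1)) ((D.pairing k₀).transport U₁) X₁ -
          (D.pairing k₀).EB (D.S (k₀ + 1)) (g' 0) (fun i => g' (i + 1)) U₁ X₁| ≤
        C₅ * θ ^ X₁.1 * Real.exp (-(κ * (domSys (F.P k₀) M X₁.1).dj X₁.2)) :=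
      h5 k₀ (by omega) (g' 0) (hg' 0).1 (hg' 0).2 _ htg' U₁ X₁
    -- the induction hypothesis one run length below, at the transported background
    have h2 := ih k₀ (by omega) _ htg _ htg' htag ((D.pairing k₀).transport U₁) X₁ (by omega) (by omega)
    rw [hkey g, hkey g', hdj k₀ X₁, hj, show X₁.1 + 1 - (a + 1) = X₁.1 - a by omega]
    set E := Real.exp (-(κ * (domSys (F.P k₀) M X₁.1).dj X₁.2)) with hE
    set A₀ := (D.pairing k₀).EA (D.S k₀) (fun i => g (i + 1)) ((D.pairing k₀).transport U₁) X₁ with hA₀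
    set A₀' := (D.pairing k₀).EA (D.S k₀) (fun i => g' (i + 1)) ((D.pairing k₀).transport U₁) X₁ with hA₀'
    set B₀ := (D.pairing k₀).EB (D.S (k₀ + 1)) (g 0) (fun i => g (i + 1)) U₁ X₁ with hB₀
    set B₀' := (D.pairing k₀).EB (D.S (k₀ + 1)) (g' 0) (fun i => g' (i + 1)) U₁ X₁ with hB₀'
    have hθ' : (1 : ℝ) - θ ≠ 0 := ne_of_gt (sub_pos.mpr hθ1)
    calc |B₀ - B₀'| ≤ |B₀ - A₀| + |A₀ - B₀'| := abs_sub_le _ _ _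
      _ ≤ |B₀ - A₀| + (|A₀ - A₀'| + |A₀' - B₀'|) := add_le_add le_rfl (abs_sub_le _ _ _)
      _ ≤ C₅ * θ ^ X₁.1 * E + (2 * C₅ / (1 - θ) * (θ ^ (X₁.1 - a) - θ ^ X₁.1) * E + C₅ * θ ^ X₁.1 * E) := by
          rw [abs_sub_comm B₀ A₀]
          exact add_le_add h1 (add_le_add h2 h1')
      _ = 2 * C₅ / (1 - θ) * (θ ^ (X₁.1 - a) - θ ^ (X₁.1 + 1)) * E := by
          rw [pow_succ]
          field_simp
          ring

/-- **(O) FOR RUN A's LEVEL FUNCTIONAL FROM NE5 AT THE PAIRING LEVELS BELOW — along the level pairings.**  Under (C1), (C2), the junk-freeness pin (J) «run A of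
length `K` has no term of creation step `> K`» and NE5 at the pairing levels `k′ < K` on `]0, γ]` with letters `(κ, θ, C₅)`, `0 ≤ C₅`, `0 ≤ θ < 1`: two
window histories agreeing at every index `≥ a`, `a ≤ j = X.1`, give level values within `(2C₅∕(1−θ))·θ^{j−a}·e^{−κ d_j(X)}` — the oscillation-fading input
(O) of the N22 slots with constant `2C₅∕(1−θ)` (the single-type tower's `oscFading_of_ne5_below`, re-derived for per-level types). [folklore] -/
theorem oscFading_EA_of_ne5_below
    (hfst : ∀ (k : ℕ) (X₁ : Node00.W1.Dom (F.P k) M), ((D.pairing k).pair X₁).1 = X₁.1 + 1)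
    (hdj : ∀ (k : ℕ) (X₁ : Node00.W1.Dom (F.P k) M),
      (domSys (F.P (k + 1)) M ((D.pairing k).pair X₁).1).dj ((D.pairing k).pair X₁).2 = (domSys (F.P k) M X₁.1).dj X₁.2)
    (hsurj : ∀ (k : ℕ) (X : Node00.W1.Dom (F.P (k + 1)) M), 1 ≤ X.1 → ∃ X₁ : Node00.W1.Dom (F.P k) M, (D.pairing k).pair X₁ = X)
    (hbg : ∀ (k : ℕ) (U : (D.pairing (k + 1)).BgA), ∃ U₁ : (D.pairing k).BgB, (D.pairing k).embB U₁ = (D.pairing (k + 1)).embA U)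
    (hjunk : ∀ (k : ℕ) (g : ℕ → ℝ) (U : (D.pairing k).BgA) (X : Node00.W1.Dom (F.P k) M), k < X.1 → (D.pairing k).EA (D.S k) g U X = 0)
    {κ θ C₅ : ℝ} (hC : 0 ≤ C₅) (hθ0 : 0 ≤ θ) (hθ1 : θ < 1)
    (h5 : ∀ k' : ℕ, k' < K → ∀ b : ℝ, 0 < b → b ≤ γ →
      NE5 (C := (D.pairing k').carriers) ((D.pairing k').EA (D.S k')) ((D.pairing k').EB (D.S (k' + 1)) b) (Window γ) κ θ C₅) :
    ∀ g ∈ Window γ, ∀ g' ∈ Window γ, ∀ (U : (D.pairing K).BgA) (X : Node00.W1.Dom (F.P K) M) (a : ℕ), a ≤ X.1 →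
      (∀ n, a ≤ n → g n = g' n) →
      |(D.pairing K).EA (D.S K) g U X - (D.pairing K).EA (D.S K) g' U X| ≤
        2 * C₅ / (1 - θ) * θ ^ (X.1 - a) * Real.exp (-(κ * (domSys (F.P K) M X.1).dj X.2)) := by
  intro g hg g' hg' U X a ha hag
  have hc : 0 ≤ 2 * C₅ / (1 - θ) := div_nonneg (by linarith) (by linarith)
  rcases Nat.lt_or_ge K X.1 with hXK | hXK
  · rw [hjunk K g U X hXK, hjunk K g' U X hXK, sub_self, abs_zero]
    positivity
  · refine (abs_EA_sub_le_of_ne5_below_aux D γ K hfst hdj hsurj hbg hθ1 h5 a K le_rfl g hg g' hg' hag U X ha hXK).trans ?_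
    have hle : θ ^ (X.1 - a) - θ ^ X.1 ≤ θ ^ (X.1 - a) := sub_le_self _ (pow_nonneg hθ0 _)
    exact mul_le_mul_of_nonneg_right (mul_le_mul_of_nonneg_left hle hc) (Real.exp_nonneg _)

end Descent

/-! ## §2 At the Stage-12 bundles of the named reading: module 7's (O) clause from node N18 below -/

section Reading

variable {F : T4Family} (θ : Stage12Params F N) {𝔸 : Type*} {M : ℕ} (D : ReadingData F 𝔸 M) (k : ℕ)

/-- **MODULE 7's (O) CLAUSE FOR THE NAMED W1 READING, FROM NODE N18 AT THE RUN LENGTHS BELOW `k`.**  `N18At (u3OfRecord₁₂ θ (D.u3Objects θ.γ) k′)` IS NE5 at pairing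
level `k′` on `]0, θ.γ]` with the inputs' letters `(li.κ, li.θ₅, li.C₅)` (`ReadingData.ne5_u3Objects_iff`, definitional); with (C1)(C2)(J), `0 ≤ li.C₅`,
`0 ≤ li.θ₅ < 1` and `2li.C₅∕(1−li.θ₅) ≤ C₀`, §1 gives the `hO` clause of `n22At_u3OfRecord₁₂_w1Reading_of_stripBound` ∕ dag-n22-e's `s_N22_rRec₁₂_w1_of_oscAnalytic`
with constant `C₀`. [folklore] -/
theorem oscFading_w1Reading_of_n18At_below
    (hfst : ∀ (k : ℕ) (X₁ : Node00.W1.Dom (F.P k) M), ((D.pairing k).pair X₁).1 = X₁.1 + 1)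
    (hdj : ∀ (k : ℕ) (X₁ : Node00.W1.Dom (F.P k) M),
      (domSys (F.P (k + 1)) M ((D.pairing k).pair X₁).1).dj ((D.pairing k).pair X₁).2 = (domSys (F.P k) M X₁.1).dj X₁.2)
    (hsurj : ∀ (k : ℕ) (X : Node00.W1.Dom (F.P (k + 1)) M), 1 ≤ X.1 → ∃ X₁ : Node00.W1.Dom (F.P k) M, (D.pairing k).pair X₁ = X)
    (hbg : ∀ (k : ℕ) (U : (D.pairing (k + 1)).BgA), ∃ U₁ : (D.pairing k).BgB, (D.pairing k).embB U₁ = (D.pairing (k + 1)).embA U)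
    (hjunk : ∀ (k : ℕ) (g : ℕ → ℝ) (U : (D.pairing k).BgA) (X : Node00.W1.Dom (F.P k) M), k < X.1 → (D.pairing k).EA (D.S k) g U X = 0)
    (hC : 0 ≤ D.li.C₅) (hθ0 : 0 ≤ D.li.θ₅) (hθ1 : D.li.θ₅ < 1) {C₀ : ℝ} (hC₀ : 2 * D.li.C₅ / (1 - D.li.θ₅) ≤ C₀)
    (h18 : ∀ k' : ℕ, k' < k → N18At (u3OfRecord₁₂ θ (D.u3Objects θ.γ) k')) :
    ∀ g ∈ Window θ.γ, ∀ g' ∈ Window θ.γ, ∀ (U : (D.pairing k).BgA) (X : (D.pairing k).carriers.Dom) (a : ℕ), a ≤ (D.pairing k).carriers.scale X →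
      (∀ n, a ≤ n → g n = g' n) → |(D.pairing k).EA (D.S k) g U X - (D.pairing k).EA (D.S k) g' U X| ≤
        C₀ * D.li.θ₅ ^ ((D.pairing k).carriers.scale X - a) * Real.exp (-(D.li.κ * (D.pairing k).carriers.d X)) := by
  intro g hg g' hg' U X a ha hag
  have h5 : ∀ k' : ℕ, k' < k → ∀ b : ℝ, 0 < b → b ≤ θ.γ →
      NE5 (C := (D.pairing k').carriers) ((D.pairing k').EA (D.S k')) ((D.pairing k').EB (D.S (k' + 1)) b) (Window θ.γ) D.li.κ D.li.θ₅ D.li.C₅ :=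
    fun k' hk' => h18 k' hk'
  refine (oscFading_EA_of_ne5_below D θ.γ k hfst hdj hsurj hbg hjunk hC hθ0 hθ1 h5 g hg g' hg' U X a ha hag).trans ?_
  exact mul_le_mul_of_nonneg_right (mul_le_mul_of_nonneg_right hC₀ (pow_nonneg hθ0 _)) (Real.exp_nonneg _)

open Classical in
/-- **`N22At` AT THE LEVEL-`k` BUNDLE OF THE NAMED W1 READING, FROM STRIP + NODE N18 BELOW `k`** — module 7 §2 `n22At_u3OfRecord₁₂_w1Reading_of_stripBound` with its
(O) hypothesis DERIVED (this module's §1 along the pairings): STRIP-(1.18) at every level in every coupling for `D.S k` with the readings `(D.pairing k).embA U`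
inside the space tables + `∀ k′ < k, N18At (u3OfRecord₁₂ θ (D.u3Objects θ.γ) k′)` + (C1)(C2)(J) + the input signs (`0 ≤ C₅`, `2C₅∕(1−θ₅) ≤ C₀`, `0 < C₀ ≤ 2A`,
`0 < θ₅ < 1`, `θ₅ ≤ μ`, `1 ≤ μ`, `0 < A`, `0 < r`, `0 < s < 1`, `0 < θ.γ`) ⟹ `N22At (u3OfRecord₁₂ θ (D.u3Objects θ.γ) k)`. [folklore] -/
theorem n22At_u3OfRecord₁₂_w1Reading_of_n18Below_stripBound
    (sp : (j : ℕ) → (domSys (F.P k) M j).Dom → Set (CPair (F.P k) 𝔸))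
    (hsp : ∀ (j : ℕ) (U : (D.pairing k).BgA) (Y : (domSys (F.P k) M j).Dom), (D.pairing k).embA U ∈ sp j Y)
    (hall : ∀ (j : ℕ) (g : ℕ → ℝ), g ∈ Window θ.γ → ∀ (i : ℕ) (Y : (domSys (F.P k) M j).Dom) (ψ : CPair (F.P k) 𝔸), ψ ∈ sp j Y →
      ∃ (Ec : ℂ → ℂ) (O : Set ℂ), IsOpen O ∧ (∀ t ∈ Ioc (0 : ℝ) θ.γ, closedBall (t : ℂ) D.li.r ⊆ O) ∧ DifferentiableOn ℂ Ec O ∧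
        (∀ z ∈ O, ‖Ec z‖ ≤ D.li.A * Real.exp (-(D.li.κ * torusTreeLen Y.1))) ∧
        (∀ t ∈ Ioc (0 : ℝ) θ.γ, Ec t = termC (D.S k) j Y (Function.update g i t) ψ))
    (hfst : ∀ (k : ℕ) (X₁ : Node00.W1.Dom (F.P k) M), ((D.pairing k).pair X₁).1 = X₁.1 + 1)
    (hdj : ∀ (k : ℕ) (X₁ : Node00.W1.Dom (F.P k) M),
      (domSys (F.P (k + 1)) M ((D.pairing k).pair X₁).1).dj ((D.pairing k).pair X₁).2 = (domSys (F.P k) M X₁.1).dj X₁.2)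
    (hsurj : ∀ (k : ℕ) (X : Node00.W1.Dom (F.P (k + 1)) M), 1 ≤ X.1 → ∃ X₁ : Node00.W1.Dom (F.P k) M, (D.pairing k).pair X₁ = X)
    (hbg : ∀ (k : ℕ) (U : (D.pairing (k + 1)).BgA), ∃ U₁ : (D.pairing k).BgB, (D.pairing k).embB U₁ = (D.pairing (k + 1)).embA U)
    (hjunk : ∀ (k : ℕ) (g : ℕ → ℝ) (U : (D.pairing k).BgA) (X : Node00.W1.Dom (F.P k) M), k < X.1 → (D.pairing k).EA (D.S k) g U X = 0)
    (h18 : ∀ k' : ℕ, k' < k → N18At (u3OfRecord₁₂ θ (D.u3Objects θ.γ) k'))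
    (hC5 : 0 ≤ D.li.C₅) (hθ1 : D.li.θ₅ < 1) (hC₀' : 2 * D.li.C₅ / (1 - D.li.θ₅) ≤ D.li.C₀)
    (hC₀ : 0 < D.li.C₀) (hθ : 0 < D.li.θ₅) (hA : 0 < D.li.A) (hμ1 : 1 ≤ D.li.μ) (hθμ : D.li.θ₅ ≤ D.li.μ) (hCM : D.li.C₀ ≤ 2 * D.li.A)
    (hr : 0 < D.li.r) (hγ : 0 < θ.γ) (hs0 : 0 < D.li.s) (hs1 : D.li.s < 1) :
    N22At (u3OfRecord₁₂ θ (D.u3Objects θ.γ) k) :=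
  n22At_u3OfRecord₁₂_w1Reading_of_stripBound θ D k sp hsp hall
    (oscFading_w1Reading_of_n18At_below θ D k hfst hdj hsurj hbg hjunk hC5 hθ.le hθ1 hC₀' h18) hC₀ hθ hA hμ1 hθμ hCM hr hγ hs0 hs1

open Classical in
/-- **`N22At` AT THE NAMED W1 READING FROM THE LEVEL-T ONE-STEP HYPOTHESIS + NODE N18 BELOW `k`** — module 7 §4 with (O) DERIVED: STRIP supplied by module 3's
`stripBound_termC_of_termwise226Strip` for `D.S k` (the displayed level-T hypothesis `h226T`, the socket numerals `Lemma3Numerics c M (½L) …`, `8 ≤ c.L`, S25's two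
clauses at `A := C₃ε₁`, `R := (1−8δ)½Lκ`, `D.li.κ ≤ r₁`, the renewal `e·9·64·K₀(64,8)²·C₃ε₁ ≤ D.li.A`), (O) by §2. [folklore] -/
theorem n22At_u3OfRecord₁₂_w1Reading_of_n18Below_termwise226Strip [NeZero M]
    (sp : (j : ℕ) → (domSys (F.P k) M j).Dom → Set (CPair (F.P k) 𝔸))
    (hsp : ∀ (j : ℕ) (U : (D.pairing k).BgA) (Y : (domSys (F.P k) M j).Dom), (D.pairing k).embA U ∈ sp j Y) (c : B13.Consts) {L : ℕ} [NeZero L]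
    (hL : 8 ≤ c.L) (hLc : c.L = L) {a a₂ a₂' a₅ Aabs : ℝ} (hN : Lemma3Numerics c M ((c.L : ℝ) / 2) a a₂ a₂' a₅ Aabs)
    {r₁ : ℝ} (hA0 : 0 ≤ c.C3act * c.ε₁) (hr₁ : 0 ≤ r₁) (hκ : D.li.κ ≤ r₁)
    (hrate : r₁ + 2 * (64 * Real.log 162) + 2 ≤ (1 - 8 * c.δ) * ((c.L : ℝ) / 2) * c.κ)
    (hsmall : c.C3act * c.ε₁ * Real.exp (5 * r₁ + 1) * K₀ 64 8 * 9 * 64 ≤ 1)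
    (hrenew : Real.exp 1 * 9 * 64 * K₀ 64 8 ^ 2 * (c.C3act * c.ε₁) ≤ D.li.A)
    (h226T : ∀ (k' : ℕ) (g : ℕ → ℝ), g ∈ Window θ.γ → ∀ (i : ℕ), i < k' + 1 → ∀ (X : (domSys (F.P k) M (k' + 1)).Dom) (φ : CPair (F.P k) 𝔸),
      φ ∈ sp (k' + 1) X →
      (∀ (j : ℕ), j < k' + 1 → ∀ (Y : (domSys (F.P k) M j).Dom) (ψ : CPair (F.P k) 𝔸), ψ ∈ sp j Y →
        ∃ (Ec : ℂ → ℂ) (O : Set ℂ), IsOpen O ∧ (∀ t ∈ Ioc (0 : ℝ) θ.γ, closedBall (t : ℂ) D.li.r ⊆ O) ∧ DifferentiableOn ℂ Ec O ∧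
          (∀ z ∈ O, ‖Ec z‖ ≤ D.li.A * Real.exp (-(D.li.κ * torusTreeLen Y.1))) ∧
          (∀ t ∈ Ioc (0 : ℝ) θ.γ, Ec t = termC (D.S k) j Y (Function.update g i t) ψ)) →
      ∃ (Hc : ℂ → TDom 4 (domCount (F.P k) M (k' + 1)) → ℂ)
        (Tt : (Z : TDom 4 (domCount (F.P k) M (k' + 1))) →
          Finset (TDom 4 (L * domCount (F.P k) M (k' + 1))) × Finset (TBond 4 M (L * domCount (F.P k) M (k' + 1))) → ℂ → ℂ)
        (O : Set ℂ), IsOpen O ∧ (∀ t ∈ Ioc (0 : ℝ) θ.γ, closedBall (t : ℂ) D.li.r ⊆ O) ∧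
        (∀ Z : (domSys (F.P k) M (k' + 1)).Dom, Z.1 ⊆ X.1 → DifferentiableOn ℂ (fun z => Hc z Z) O) ∧
        (∀ z ∈ O, ∀ Z : TDom 4 (domCount (F.P k) M (k' + 1)), Z.1 ⊆ X.1 → ‖Hc z Z‖ ≤ ∑ t ∈ terms L M Z, ‖Tt Z t z‖) ∧
        (∀ z ∈ O, ∀ Z : TDom 4 (domCount (F.P k) M (k' + 1)), Z.1 ⊆ X.1 → ∀ t ∈ terms L M Z,
          ‖Tt Z t z‖ ≤ weight L M c Z a t * Real.exp (a₅ * ((Z.1).card : ℝ))) ∧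
        (∀ t ∈ Ioc (0 : ℝ) θ.γ, Hc t = ((D.S k) k').H (restrictPrefix k' (Function.update g i t)) φ))
    (hfst : ∀ (k : ℕ) (X₁ : Node00.W1.Dom (F.P k) M), ((D.pairing k).pair X₁).1 = X₁.1 + 1)
    (hdj : ∀ (k : ℕ) (X₁ : Node00.W1.Dom (F.P k) M),
      (domSys (F.P (k + 1)) M ((D.pairing k).pair X₁).1).dj ((D.pairing k).pair X₁).2 = (domSys (F.P k) M X₁.1).dj X₁.2)
    (hsurj : ∀ (k : ℕ) (X : Node00.W1.Dom (F.P (k + 1)) M), 1 ≤ X.1 → ∃ X₁ : Node00.W1.Dom (F.P k) M, (D.pairing k).pair X₁ = X)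
    (hbg : ∀ (k : ℕ) (U : (D.pairing (k + 1)).BgA), ∃ U₁ : (D.pairing k).BgB, (D.pairing k).embB U₁ = (D.pairing (k + 1)).embA U)
    (hjunk : ∀ (k : ℕ) (g : ℕ → ℝ) (U : (D.pairing k).BgA) (X : Node00.W1.Dom (F.P k) M), k < X.1 → (D.pairing k).EA (D.S k) g U X = 0)
    (h18 : ∀ k' : ℕ, k' < k → N18At (u3OfRecord₁₂ θ (D.u3Objects θ.γ) k'))
    (hC5 : 0 ≤ D.li.C₅) (hθ1 : D.li.θ₅ < 1) (hC₀' : 2 * D.li.C₅ / (1 - D.li.θ₅) ≤ D.li.C₀)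
    (hC₀ : 0 < D.li.C₀) (hθ : 0 < D.li.θ₅) (hA : 0 < D.li.A) (hμ1 : 1 ≤ D.li.μ) (hθμ : D.li.θ₅ ≤ D.li.μ) (hCM : D.li.C₀ ≤ 2 * D.li.A)
    (hr : 0 < D.li.r) (hγ : 0 < θ.γ) (hs0 : 0 < D.li.s) (hs1 : D.li.s < 1) :
    N22At (u3OfRecord₁₂ θ (D.u3Objects θ.γ) k) :=
  n22At_u3OfRecord₁₂_w1Reading_of_n18Below_stripBound θ D k sp hsp
    (stripBound_termC_of_termwise226Strip F k (D.S k) sp c hL hLc hN hr.le hA0 hr₁ hκ hrate hsmall hrenew h226T)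
    hfst hdj hsurj hbg hjunk h18 hC5 hθ1 hC₀' hC₀ hθ hA hμ1 hθμ hCM hr hγ hs0 hs1

end Reading

/-! ## §3 THE EDGE at the reading of record: `S_N18 (RRec₁₂ 𝔯_W1)` + STRIP + coherence + numerals ⟹ `S_N22 (RRec₁₂ 𝔯_W1)` -/

section Record

variable (𝔇 : AssignmentInputs₁₂ N) (ne1 : (F : T4Family) → Stage12Params F N → (ℕ → ℝ) → List (ULoop F) → NE1pCarriers)

open Classical in
/-- **THE EDGE N18 → N22 AT THE NAMED W1 READING OF RECORD.**  For 𝔇's reading `𝔯_W1 := RateReading₁₂.ofAssignment (W1.assignment₁₂ 𝔇) ne1`: node N18's stub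
`S_N18 (RRec₁₂ 𝔯_W1)` (NE5 at every Stage-12 datum key and pairing level, layer B's `s_N18_rRec₁₂_iff`), TOGETHER WITH, per admissible Stage-12 tuple with provisos
(θ-form): the pairing coherence (C1)(C2) and junk-freeness (J) of `𝔇.w1 F θ`, the inputs' numerals (dag-n22-e's eight + `1 ≤ li.μ` + `θ₅ < 1`, `0 ≤ C₅`,
`2C₅∕(1−θ₅) ≤ C₀`), and per run length `k` a space table on the `k`-th torus with the readings `embA U` inside and STRIP-(1.18) at every level in every coupling
for `(𝔇.w1 F θ).S k` (module 7 §3's `hstrip` verbatim; modules 1∕3 produce it from the level-T one-step hypothesis) ⟹ `S_N22 (RRec₁₂ 𝔯_W1)`.  Proof: datum form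
(dag-n22-e's `s_N22_rRec₁₂_w1_iff`), N18 at every run length from the stub at the same datum key, then §2. [folklore] -/
theorem s_N22_rRec₁₂_w1Assignment_of_s_N18_stripBound
    (h18 : S_N18 (RRec₁₂ (RateReading₁₂.ofAssignment (assignment₁₂ 𝔇) ne1)))
    (hcoh : ∀ (F : T4Family) (θ : Stage12Params F N), θ.Provisos₁₂ F N → θ.Admissible F N →
      (∀ (k : ℕ) (X₁ : Node00.W1.Dom (F.P k) θ.τ9.M), (((𝔇.w1 F θ).pairing k).pair X₁).1 = X₁.1 + 1) ∧
      (∀ (k : ℕ) (X₁ : Node00.W1.Dom (F.P k) θ.τ9.M),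
        (domSys (F.P (k + 1)) θ.τ9.M (((𝔇.w1 F θ).pairing k).pair X₁).1).dj (((𝔇.w1 F θ).pairing k).pair X₁).2 =
          (domSys (F.P k) θ.τ9.M X₁.1).dj X₁.2) ∧
      (∀ (k : ℕ) (X : Node00.W1.Dom (F.P (k + 1)) θ.τ9.M), 1 ≤ X.1 → ∃ X₁ : Node00.W1.Dom (F.P k) θ.τ9.M, ((𝔇.w1 F θ).pairing k).pair X₁ = X) ∧
      (∀ (k : ℕ) (U : ((𝔇.w1 F θ).pairing (k + 1)).BgA), ∃ U₁ : ((𝔇.w1 F θ).pairing k).BgB,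
        ((𝔇.w1 F θ).pairing k).embB U₁ = ((𝔇.w1 F θ).pairing (k + 1)).embA U) ∧
      (∀ (k : ℕ) (g : ℕ → ℝ) (U : ((𝔇.w1 F θ).pairing k).BgA) (X : Node00.W1.Dom (F.P k) θ.τ9.M), k < X.1 →
        ((𝔇.w1 F θ).pairing k).EA ((𝔇.w1 F θ).S k) g U X = 0))
    (hnum : ∀ (F : T4Family) (θ : Stage12Params F N), θ.Provisos₁₂ F N → θ.Admissible F N →
      0 < (𝔇.w1 F θ).li.C₀ ∧ 0 < (𝔇.w1 F θ).li.θ₅ ∧ (𝔇.w1 F θ).li.θ₅ < 1 ∧ 0 ≤ (𝔇.w1 F θ).li.C₅ ∧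
        2 * (𝔇.w1 F θ).li.C₅ / (1 - (𝔇.w1 F θ).li.θ₅) ≤ (𝔇.w1 F θ).li.C₀ ∧ 0 < (𝔇.w1 F θ).li.A ∧ (𝔇.w1 F θ).li.θ₅ ≤ (𝔇.w1 F θ).li.μ ∧
        (𝔇.w1 F θ).li.C₀ ≤ 2 * (𝔇.w1 F θ).li.A ∧ 0 < (𝔇.w1 F θ).li.r ∧ 0 < (𝔇.w1 F θ).li.s ∧ (𝔇.w1 F θ).li.s < 1 ∧ 1 ≤ (𝔇.w1 F θ).li.μ)
    (hstrip : ∀ (F : T4Family) (θ : Stage12Params F N), θ.Provisos₁₂ F N → θ.Admissible F N → ∀ (k : ℕ),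
      ∃ sp : (j : ℕ) → (domSys (F.P k) θ.τ9.M j).Dom → Set (CPair (F.P k) (MatA N)),
        (∀ (j : ℕ) (U : ((𝔇.w1 F θ).pairing k).BgA) (Y : (domSys (F.P k) θ.τ9.M j).Dom), ((𝔇.w1 F θ).pairing k).embA U ∈ sp j Y) ∧
        (∀ (j : ℕ) (g : ℕ → ℝ), g ∈ Window θ.γ → ∀ (i : ℕ) (Y : (domSys (F.P k) θ.τ9.M j).Dom) (ψ : CPair (F.P k) (MatA N)), ψ ∈ sp j Y →
          ∃ (Ec : ℂ → ℂ) (O : Set ℂ), IsOpen O ∧ (∀ t ∈ Ioc (0 : ℝ) θ.γ, closedBall (t : ℂ) (𝔇.w1 F θ).li.r ⊆ O) ∧ DifferentiableOn ℂ Ec O ∧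
            (∀ z ∈ O, ‖Ec z‖ ≤ (𝔇.w1 F θ).li.A * Real.exp (-((𝔇.w1 F θ).li.κ * torusTreeLen Y.1))) ∧
            (∀ t ∈ Ioc (0 : ℝ) θ.γ, Ec t = termC ((𝔇.w1 F θ).S k) j Y (Function.update g i t) ψ))) :
    S_N22 (RRec₁₂ (RateReading₁₂.ofAssignment (assignment₁₂ 𝔇) ne1)) := by
  rw [YMDAG.N22.s_N22_rRec₁₂_w1_iff]
  intro F D h k
  have h18' : ∀ k' : ℕ, N18At (u3OfRecord₁₂ h.params ((𝔇.w1 F h.params).u3Objects h.params.γ) k') :=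
    fun k' => (s_N18_rRec₁₂_iff (RateReading₁₂.ofAssignment (assignment₁₂ 𝔇) ne1)).1 h18 F D h (fun _ => 0) [] k'
  obtain ⟨hfst, hdj, hsurj, hbg, hjunk⟩ := hcoh F h.params h.provisos h.admissible
  obtain ⟨hC₀, hθ, hθ1, hC5, hC₀', hA, hθμ, hCM, hr, hs0, hs1, hμ1⟩ := hnum F h.params h.provisos h.admissible
  obtain ⟨sp, hsp, hall⟩ := hstrip F h.params h.provisos h.admissible k
  exact n22At_u3OfRecord₁₂_w1Reading_of_n18Below_stripBound h.params (𝔇.w1 F h.params) k sp hsp hall hfst hdj hsurj hbg hjunk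
    (fun k' _ => h18' k') hC5 hθ1 hC₀' hC₀ hθ hA hμ1 hθμ hCM hr h.gamma_pos hs0 hs1

end Record

/-! ## §3b The same edge at dag-n22-e's edition-1 reading of record `readingOfRecord₁₂ w1 ℓ₃ ne2 ne1` -/

section Edition1

variable (w1 : (F : T4Family) → (θ : Stage12Params F N) → ReadingData F (MatA N) θ.τ9.M) (ℓ₃ : T4Family → Node00.NE3Letters₁₁)
  (ne2 : (F : T4Family) → Stage12Params F N → (ℕ → ℝ) → List (ULoop F) → ℕ → Node00.NE2Objects₁₁)
  (ne1 : (F : T4Family) → Stage12Params F N → (ℕ → ℝ) → List (ULoop F) → NE1pCarriers)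

open Classical in
/-- **THE EDGE N18 → N22 AT THE RATE READING OF RECORD, EDITION 1** (dag-n22-e g2's `readingOfRecord₁₂ w1 ℓ₃ ne2 ne1` = `RateReading₁₂.ofAssignment (W1.assignment₁₂
(pinnedInputs₁₂ w1 ℓ₃ ne2)) ne1`, p469629): §3 at `𝔇 := pinnedInputs₁₂ w1 ℓ₃ ne2` (`𝔇.w1 = w1` by `rfl`) — `S_N18 (RRec₁₂ (readingOfRecord₁₂ w1 ℓ₃ ne2 ne1))` + coherence +
junk-freeness + numerals + STRIP per run length ⟹ `S_N22 (RRec₁₂ (readingOfRecord₁₂ w1 ℓ₃ ne2 ne1))`. [folklore] -/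
theorem s_N22_readingOfRecord₁₂_of_s_N18_stripBound
    (h18 : S_N18 (RRec₁₂ (readingOfRecord₁₂ w1 ℓ₃ ne2 ne1)))
    (hcoh : ∀ (F : T4Family) (θ : Stage12Params F N), θ.Provisos₁₂ F N → θ.Admissible F N →
      (∀ (k : ℕ) (X₁ : Node00.W1.Dom (F.P k) θ.τ9.M), (((w1 F θ).pairing k).pair X₁).1 = X₁.1 + 1) ∧
      (∀ (k : ℕ) (X₁ : Node00.W1.Dom (F.P k) θ.τ9.M),
        (domSys (F.P (k + 1)) θ.τ9.M (((w1 F θ).pairing k).pair X₁).1).dj (((w1 F θ).pairing k).pair X₁).2 =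
          (domSys (F.P k) θ.τ9.M X₁.1).dj X₁.2) ∧
      (∀ (k : ℕ) (X : Node00.W1.Dom (F.P (k + 1)) θ.τ9.M), 1 ≤ X.1 → ∃ X₁ : Node00.W1.Dom (F.P k) θ.τ9.M, ((w1 F θ).pairing k).pair X₁ = X) ∧
      (∀ (k : ℕ) (U : ((w1 F θ).pairing (k + 1)).BgA), ∃ U₁ : ((w1 F θ).pairing k).BgB,
        ((w1 F θ).pairing k).embB U₁ = ((w1 F θ).pairing (k + 1)).embA U) ∧
      (∀ (k : ℕ) (g : ℕ → ℝ) (U : ((w1 F θ).pairing k).BgA) (X : Node00.W1.Dom (F.P k) θ.τ9.M), k < X.1 →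
        ((w1 F θ).pairing k).EA ((w1 F θ).S k) g U X = 0))
    (hnum : ∀ (F : T4Family) (θ : Stage12Params F N), θ.Provisos₁₂ F N → θ.Admissible F N →
      0 < (w1 F θ).li.C₀ ∧ 0 < (w1 F θ).li.θ₅ ∧ (w1 F θ).li.θ₅ < 1 ∧ 0 ≤ (w1 F θ).li.C₅ ∧
        2 * (w1 F θ).li.C₅ / (1 - (w1 F θ).li.θ₅) ≤ (w1 F θ).li.C₀ ∧ 0 < (w1 F θ).li.A ∧ (w1 F θ).li.θ₅ ≤ (w1 F θ).li.μ ∧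
        (w1 F θ).li.C₀ ≤ 2 * (w1 F θ).li.A ∧ 0 < (w1 F θ).li.r ∧ 0 < (w1 F θ).li.s ∧ (w1 F θ).li.s < 1 ∧ 1 ≤ (w1 F θ).li.μ)
    (hstrip : ∀ (F : T4Family) (θ : Stage12Params F N), θ.Provisos₁₂ F N → θ.Admissible F N → ∀ (k : ℕ),
      ∃ sp : (j : ℕ) → (domSys (F.P k) θ.τ9.M j).Dom → Set (CPair (F.P k) (MatA N)),
        (∀ (j : ℕ) (U : ((w1 F θ).pairing k).BgA) (Y : (domSys (F.P k) θ.τ9.M j).Dom), ((w1 F θ).pairing k).embA U ∈ sp j Y) ∧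
        (∀ (j : ℕ) (g : ℕ → ℝ), g ∈ Window θ.γ → ∀ (i : ℕ) (Y : (domSys (F.P k) θ.τ9.M j).Dom) (ψ : CPair (F.P k) (MatA N)), ψ ∈ sp j Y →
          ∃ (Ec : ℂ → ℂ) (O : Set ℂ), IsOpen O ∧ (∀ t ∈ Ioc (0 : ℝ) θ.γ, closedBall (t : ℂ) (w1 F θ).li.r ⊆ O) ∧ DifferentiableOn ℂ Ec O ∧
            (∀ z ∈ O, ‖Ec z‖ ≤ (w1 F θ).li.A * Real.exp (-((w1 F θ).li.κ * torusTreeLen Y.1))) ∧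
            (∀ t ∈ Ioc (0 : ℝ) θ.γ, Ec t = termC ((w1 F θ).S k) j Y (Function.update g i t) ψ))) :
    S_N22 (RRec₁₂ (readingOfRecord₁₂ w1 ℓ₃ ne2 ne1)) :=
  s_N22_rRec₁₂_w1Assignment_of_s_N18_stripBound (pinnedInputs₁₂ w1 ℓ₃ ne2) ne1 h18 hcoh hnum hstrip

end Edition1

end YMDAG.N22.W1

end
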